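import Summits.QuantumFields.YangMills.Theorems.BalabanUVNodesN12AtRecord13Sep
import Literature.MathematicalPhysics.QuantumFieldTheory.Balaban1983to89.Node00.Record13Co

/-!
# BalabanUVNodes ∕ N12 — N12's STAGE-13 STOREY KEYED ONCE ON node00-def-T's bg-FREE CORE RECORD AT PRINT'S BACKGROUND (`Provisos₁₃Core`, `datumOfRecord₁₃Co`,
# `IsRecordOfRecord₁₃CCo`, `toStage5₁₃Co` — FILE 21 `Node00/Record13Co`, p515035, director-ym №152 (β) = the edition of record) — serves every Co-datum proviso edition at `h.toCore`
# (v1.4 `Provisos₁₃SepCo` and successors; plan g67 CORE-YES, def-T g15 «key ONCE on Core where you read no proviso row», №153 «the live Core consumers re-key themselves») (Track A, DAG node N12 = [B15, Balaban1989LargeFieldI] CMP **122** (1989) 175–202; cluster K1 (K1⁗ `StabilityBAtRecordR13Sep` = stmt-QuantumFields-20290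
# → K1⁵ at rev 20 on def-T's v1.4 `SepCo`); seat `pub-ymgap-dag-n12-d` g9 (R134 s2 «knit at the record»), 2026-08-27; count-neutral, NOT a discharge)

HONEST FRAMING.  Count-neutral kernel RE-KEYING BY NAME of this seat's 12G §3 ∕ 12J §2–§3 storey (pre-152 U_old siblings) under def-T's KEY-RULE-21 (`Provisos₁₃Sep[Mixed] ↦ Provisos₁₃Core`,
`datumOfRecord₁₃Sep[Mixed] ↦ datumOfRecord₁₃Co`, `IsRecordOfRecord₁₃CSep[Mixed] ↦ IsRecordOfRecord₁₃CCo`, `toStage5₁₃ ↦ toStage5₁₃Co`; node00-def-T FILE 21 `Node00/Record13Co` p515035: RECORD 13 at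
print's background `UbgOfRecord₁₃Co` — the minimiser over [6]'s class (1.7)∧(1.9), def-R FILE 22 — with the bg-free CORE RECORD FAMILY `IsRecordOfRecord₁₃CCo`, clause order identical to every
edition's record predicate), over dag-n10-d's background-free CORE pin face `Provisos₁₃Core.pinW` (`Record13CarriersSep` §1; the W-pin's datum ∕ Stage-5 view identities are `rfl`),
this seat's 12E (proviso-FREE rows at a live re-pin carrying K0b's residuals) and g4 `exists_printedCarriers15_b15Leaf`.  N12 READS NO PROVISO ROW of any edition beyond the core's
`rstep` (and at a live re-pin not even that) — N12's ROWS (12E ∕ 14C ∕ 12F ∕ 12I ∕ 12L ∕ 12N) are background-FREE and stand through the (β) re-base untouched: so its storey keys ONCE here; a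
consumer holding `h : Provisos₁₃<E>` of ANY Co-datum edition E (v1.4 `Provisos₁₃SepCo`, …) applies these at `h.toCore` and reads a CORE record of `datumOfRecord₁₃Co θ h.toCore` (= E's own datum by
def-T's `datumOfRecord₁₃<E>_eq_co : rfl`); the ITEM-FACING ∃-shapes that must conclude an edition's record predicate are the thin per-edition layer (the `SepCo` layer after KEY-21T).  Nothing of Bałaban's is asserted or proved; NO estimate; the
(1.100) pin equation, live-mass, Proposition 1 (1.78), (1.80), (1.89) stay DISPLAYED; N12 is NOT discharged; counts unmoved (Track A discharged 5∕28).  ONE finite four-torus programme at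
fixed `ε = L^{-K}` — nothing continuum ∕ ℝ⁴ ∕ OS ∕ mass gap ∕ Clay.

WHAT THIS FILE GIVES (all count-neutral, EDITION-FREE):
* §1 THE STOREY AT THE CORE RECORD: `exists_record₁₃CCo_pinWWorld_b15_main_of_leaf` (admissible `θ`, `h : Provisos₁₃Core`, any leaf-carrying `W₀`: a CORE record of `datumOfRecord₁₃Co θ h`
  at the W-pinned world with `Dag.B15_main` at every run), census `exists_pinWWorld_b15_main_degenerate`, `…_of_leafOfRecord` (W at the bundle of record), ★ `…_liveRepin₁₃_of_massLive_of_hasResiduals`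
  (N12's row from its per-run displays by 12E), ★★ `exists_guarded_record₁₃CCo_b15_main_liveRepin₁₃_…` (the rung-1 N12-only ∃-shape at the CORE record, guard a theorem of K0b ∕ K0a),
  ★★★ `…_theta13OfThm1C_of_massLive` (at `θ₁₅ᶜ`).
* §2 THE MIXED W-PIN AT THE CORE RECORD: `exists_mixedPinW_record₁₃CCo_b15_main_of_leafBelow`, ★ `…_liveRepin₁₃_…`, ★★ `exists_guarded_record₁₃CCo_…_below`, ★★★ `…theta13OfThm1C…_below`
  — NO `K ≤ kSel P` leaf.
WHAT N12 THEN COSTS per run (typing strength, NOT a second gap): as in 12I ∕ 12L ∕ 12N's ★★★ lists; the edition-side input is `h.toCore` of whatever proviso package the closer holds.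

Sources: [Balaban1989LargeFieldI] (0.2)–(0.6) p.176, p.176 ll.14–16, Prop. 1 (1.78) p.194, (1.80) p.195, (1.89) p.198, (1.99)–(1.102) pp.200–201; [Balaban1988Convergent] (2.18) p.257,
(3.16)–(3.25) pp.268–270; [Balaban1989LargeFieldII] Thm 1 + (0.1) pp.355–356 (the record; bookkeeping).
-/

noncomputable section

open MeasureTheory
open scoped Matrix.Norms.L2Operator

namespace Summit.QuantumFields.YangMills.BalabanUVNodes.N12AtRecord13Co

open Literature.MathematicalPhysics.QuantumFieldTheory.Balaban1983to89
open Literature.MathematicalPhysics.QuantumFieldTheory.Balaban1983to89.T4Continuum (T4Family)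
open Literature.MathematicalPhysics.QuantumFieldTheory.Balaban1983to89.DagBinding
open Literature.MathematicalPhysics.QuantumFieldTheory.Balaban1983to89.Node00
open B15Claim189Assembly (new189 chiPP dom)
open B15 (Prop1Printed Ineq180)
open B15.BasicStep (Claim189)
open B15Sect1Statements (Normalization1102)
open B8Eq17ClassAkV1 (plaqsOf)
open B15RPrime1100OfRep (rPrimeDataOfSel)

variable {N : ℕ} [NeZero N] {F : T4Family}


/-! ## §1 N12's ₁₃ STOREY AT THE bg-FREE CORE RECORD — «an `IsRecordOfRecord₁₃CCo` record of θ's OWN `datumOfRecord₁₃Co` with `Dag.B15_main` at every run» at the C-binding of the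
W-PINNED Stage-13 view, W READ AT THE BUNDLE OF RECORD; at a live re-pin carrying K0b's residuals N12's row from its per-run displays and the guard a THEOREM -/

section Storey
variable (θ : Stage13Params F N)

/-- **FOR EVERY ADMISSIBLE STAGE-13 PACKAGE WITH THE CORE PROVISOS AND ANY PER-RUN [IV] BUNDLE FAMILY `W₀` CARRYING THE LEAF, THE WORLD BOUND AT THE C-BINDING OF THE W-PINNED
STAGE-13 VIEW IS A CORE ₁₃C RECORD OF θ's OWN CORE DATUM WITH `Dag.B15_main` AT EVERY RUN** (any window `γw ∈ ]0, θ.γ]`, block size `θ.L`; the pin is UP-SIDE — dag-n10-d's CORE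
face `Provisos₁₃Core.pinW` (`Record13CarriersSep` §1; the datum pin is `rfl`), `pinW_admissible_iff`, node00-def-T's eight-tuple `IsRecordOfRecord₁₃CCo` (FILE 21); N12 reads `W₀` there: g30's
`upOfRecord₅C_pinW_rBasicStep_iff` along the `rfl` identity `(θ.pinW W₀).toStage5₁₃Co = (θ.toStage5₁₃Co).pinW W₀`).  HONESTY (R433 species, this seat's g4 `exists_printedCarriers15_b15Leaf`): at a GENERIC `W₀` the leaf is junk-inhabitable —
the contentful instances read `W₀ := WOfRecord₁₃ θ λ` (below).  Every edition's package `h` reads this at `h.toCore` (same datum, `rfl`); count-neutral.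
[cite: Balaban1989LargeFieldI, (0.2)–(0.6) p.176, Prop. 1 p.194; Balaban1989LargeFieldII, Thm 1 + (0.1) pp.355–356 (the record; bookkeeping)] -/
theorem exists_record₁₃CCo_pinWWorld_b15_main_of_leaf (h : θ.Provisos₁₃Core F N) (hθ : θ.Admissible F N) (W₀ : B12.RunParams → PrintedCarriers15)
    {γw : ℝ} (hγw : 0 < γw ∧ γw ≤ θ.γ) (hleaf : ∀ P, B15Leaf (W₀ P)) :
    ∃ w : WorldP, IsRecordOfRecord₁₃CCo F N (datumOfRecord₁₃Co F N θ h) w ∧ w.γ = γw ∧ w.L = (θ.L : ℝ) ∧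
      (∀ P, w.up P = upOfRecord₅C F N ((θ.pinW F N W₀).toStage5₁₃Co F N) P) ∧ ∀ P : B12.RunParams, Dag.B15_main (leavesP w P) := by
  obtain ⟨w₀⟩ := nonempty_worldP
  let w : WorldP :=
    { w₀ with
      C := (datumOfRecord₁₃Co F N θ h).C, γ := γw, L := (θ.L : ℝ), one_lt_L := by exact_mod_cast θ.hL.2,
      up := fun P => upOfRecord₅C F N ((θ.pinW F N W₀).toStage5₁₃Co F N) P }
  refine ⟨w, ⟨θ.pinW F N W₀, h.pinW W₀, (Stage13Params.pinW_admissible_iff F N θ W₀).2 hθ, rfl, rfl, hγw, rfl,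
    fun _ => rfl⟩, rfl, rfl, fun _ => rfl, fun P => ?_⟩
  exact B15LeafKnit.b15_main_of_up (U := upOfRecord₅C F N ((θ.pinW F N W₀).toStage5₁₃Co F N) P) rfl
    ((upOfRecord₅C_pinW_rBasicStep_iff F N (θ.toStage5₁₃Co F N) W₀ P).2 (hleaf P))

/-- **CENSUS (R433 species, kernel form): THE GENERIC-`W₀` STOREY IS JUNK-INHABITABLE AT EVERY ADMISSIBLE CORE PACKAGE** — a DEGENERATE [IV] bundle carries `B15Leaf` (this seat's g4
`exists_printedCarriers15_b15Leaf`: empty index, empty Proposition-1 carrier, trivial (1.89) ∕ (1.102) letters), so SOME `W₀` presents a core record of `datumOfRecord₁₃Co θ h` with `Dag.B15_main` at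
every run WITHOUT any [IV] input.  Hence only the forms with W read AT THE BUNDLE OF RECORD (below) measure N12. [cite: Balaban1989LargeFieldI, (0.2) p.176, Prop. 1 p.194 (bookkeeping: the typed conjuncts read the carrier)] -/
theorem exists_pinWWorld_b15_main_degenerate (h : θ.Provisos₁₃Core F N) (hθ : θ.Admissible F N) {γw : ℝ} (hγw : 0 < γw ∧ γw ≤ θ.γ) :
    ∃ (W₀ : B12.RunParams → PrintedCarriers15) (w : WorldP), IsRecordOfRecord₁₃CCo F N (datumOfRecord₁₃Co F N θ h) w ∧ w.γ = γw ∧ w.L = (θ.L : ℝ) ∧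
      (∀ P, w.up P = upOfRecord₅C F N ((θ.pinW F N W₀).toStage5₁₃Co F N) P) ∧ ∀ P : B12.RunParams, Dag.B15_main (leavesP w P) := by
  obtain ⟨W, hW⟩ := N12AtRecord12Pointed.exists_printedCarriers15_b15Leaf (F.P 0)
  exact ⟨fun _ => W, exists_record₁₃CCo_pinWWorld_b15_main_of_leaf θ h hθ (fun _ => W) hγw fun _ => hW⟩

/-- **… W READ AT THE BUNDLE OF RECORD `WOfRecord₁₃ θ λ`** (dag-n10-d's `Record13Carriers.WOfRecord₁₃`: n12-a's `WOfRepr` at `Tstep rep_k` of record, the selector and the fibres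
along the ₁₃ histories): the N12 row HANDED run by run. [cite: Balaban1989LargeFieldI, (0.2)–(0.6) p.176, Prop. 1 p.194, (1.80), (1.89), (1.99)–(1.102); Balaban1989LargeFieldII, Thm 1 + (0.1) pp.355–356 (bookkeeping)] -/
theorem exists_record₁₃CCo_pinWWorld_b15_main_of_leafOfRecord (h : θ.Provisos₁₃Core F N) (hθ : θ.Admissible F N) (lamW : ResidW F N)
    {γw : ℝ} (hγw : 0 < γw ∧ γw ≤ θ.γ) (h12 : ∀ P, B15Leaf (WOfRecord₁₃ F N θ lamW P)) :
    ∃ w : WorldP, IsRecordOfRecord₁₃CCo F N (datumOfRecord₁₃Co F N θ h) w ∧ w.γ = γw ∧ w.L = (θ.L : ℝ) ∧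
      (∀ P, w.up P = upOfRecord₅C F N ((θ.pinW F N (WOfRecord₁₃ F N θ lamW)).toStage5₁₃Co F N) P) ∧ ∀ P : B12.RunParams, Dag.B15_main (leavesP w P) :=
  exists_record₁₃CCo_pinWWorld_b15_main_of_leaf θ h hθ (WOfRecord₁₃ F N θ lamW) hγw h12

end Storey

section LiveStorey
variable (Θ : Stage13Params F N) (lamW : ResidW F N)

/-- **★ N12's CORE STOREY AT THE ₁₃ LIVE RE-PIN OF A PARAMETER CARRYING K0b's RESIDUALS, N12's ROW FROM ITS PER-RUN DISPLAYS** (W read at the bundle of record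
`WOfRecord₁₃ (Θ.liveRepin₁₃) λ`; the row by 12E's ★★ `b15Leaf_WOfRecord₁₃_liveRepin₁₃_all_of_massLive_of_hasResiduals`: below the torus the (1.100) pin equation + «every LIVE pre-𝐑 term at
level `kSel P + 1` has positive mass» + Prop. 1 (1.78) + (1.80) + (1.89); on runs with `K ≤ kSel P` the leaf handed).  Edition-side input: `h : Provisos₁₃Core` at the re-pin (i.e. `hE.toCore` of the closer's package; for the
datum and the record predicate ONLY) and admissibility. [cite: Balaban1989LargeFieldI, (0.2)–(0.6) p.176, p.176 ll.14–16, Prop. 1 (1.78) p.194, (1.80) p.195, (1.89) p.198, (1.99)–(1.102) pp.200–201; Balaban1988Convergent, (3.16) p.268, (3.22)–(3.25) pp.269–270; Balaban1989LargeFieldII, Thm 1 + (0.1) pp.355–356] -/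
theorem exists_record₁₃CCo_pinWWorld_b15_main_liveRepin₁₃_of_massLive_of_hasResiduals (hres : Θ.HasResidualsOfRecord F N)
    (h : (Θ.liveRepin₁₃ F N).Provisos₁₃Core F N) (hθ : Θ.Admissible F N) {γw : ℝ} (hγw : 0 < γw ∧ γw ≤ Θ.γ)
    (h12deg : ∀ P : B12.RunParams, P.K ≤ lamW.kSel P → B15Leaf (WOfRecord₁₃ F N (Θ.liveRepin₁₃ F N) lamW P))
    (h12pin : ∀ P : B12.RunParams, lamW.kSel P < P.K → lamW.D1100 P
      = rPrimeDataOfSel (reprTOfRecord₁₃ F N (Θ.liveRepin₁₃ F N) P (lamW.kSel P))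
          ((Θ.liveRepin₁₃ F N).ppSel P (gOfRecord₁₃ F N (Θ.liveRepin₁₃ F N) P) (lamW.kSel P + 1))
          (fibOfSeq F (Θ.liveRepin₁₃ F N).ν (Θ.liveRepin₁₃ F N).τ9 P (gOfRecord₁₃ F N (Θ.liveRepin₁₃ F N) P) (lamW.kSel P + 1)))
    (h12mass : ∀ P : B12.RunParams, lamW.kSel P < P.K → ∀ s, LiveSeq F N Θ.ν Θ.τ9 P (gOfRecord₁₃ F N (Θ.liveRepin₁₃ F N) P) (lamW.kSel P + 1)
        (slotsTOfRecord F N Θ.ν Θ.τ9 (EOfRecord₁₃ F N (Θ.liveRepin₁₃ F N)) (wOfRecord₉ F N (Θ.liveRepin₁₃ F N).toStage9Params)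
          (Θ.liveRepin₁₃ F N).ppSel P (gOfRecord₁₃ F N (Θ.liveRepin₁₃ F N) P) (lamW.kSel P + 1)) s →
      0 < ∫ V, rterm (reprTOfRecord₁₃ F N (Θ.liveRepin₁₃ F N) P (lamW.kSel P)) s V ∂(fieldMeasure (F.P P.K) (lamW.kSel P + 1) (SU N)))
    (h12P1 : ∀ P : B12.RunParams, lamW.kSel P < P.K → Prop1Printed (lamW.LF P))
    (h12i180 : ∀ P : B12.RunParams, lamW.kSel P < P.K → ∀ U, new189 (lamW.D189 P) U → ∀ i, (lamW.D189 P).h ≤ i → i ≤ (lamW.D189 P).k →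
      ∀ q ∈ plaqsOf (dom (lamW.D189 P) i),
        Ineq180 ((lamW.D189 P).dev0 U q) ((lamW.D189 P).ε (lamW.D189 P).k) (lamW.D189 P).η (lamW.D189 P).B₃ (lamW.D189 P).B₅ (lamW.D189 P).M (lamW.D189 P).δ
          ((lamW.D189 P).dist q) (lamW.D189 P).O1)
    (h12c189 : ∀ P : B12.RunParams, lamW.kSel P < P.K → Claim189 (new189 (lamW.D189 P)) (chiPP (lamW.D189 P))) :
    ∃ w : WorldP, IsRecordOfRecord₁₃CCo F N (datumOfRecord₁₃Co F N (Θ.liveRepin₁₃ F N) h) w ∧ w.γ = γw ∧ w.L = ((Θ.liveRepin₁₃ F N).L : ℝ) ∧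
      (∀ P, w.up P = upOfRecord₅C F N (((Θ.liveRepin₁₃ F N).pinW F N (WOfRecord₁₃ F N (Θ.liveRepin₁₃ F N) lamW)).toStage5₁₃Co F N) P) ∧
        ∀ P : B12.RunParams, Dag.B15_main (leavesP w P) :=
  exists_record₁₃CCo_pinWWorld_b15_main_of_leafOfRecord (Θ.liveRepin₁₃ F N) h hθ.liveRepin₁₃ lamW hγw
    (N12AtRecord13OfResiduals.b15Leaf_WOfRecord₁₃_liveRepin₁₃_all_of_massLive_of_hasResiduals Θ lamW hres h12deg h12pin h12mass h12P1 h12i180 h12c189)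

/-- **★★ THE RUNG-1 ∃-SHAPE AT THE CORE RECORD (plan g67's `stub_nodes13P` shape with the CORE record predicate — NOT an item text: items key on an edition), N12's CONJUNCT ONLY, WITNESSED BY
`(Θ.liveRepin₁₃, h, w)` — GUARD AND N12's ROW THEOREMS OF K0b's RESIDUALS + N12's PER-RUN DISPLAYS**: `∃ θ' h' w, (ZtUnity ∧ SlotsNondegenerate₁₃) ∧ Admissible ∧ IsRecordOfRecord₁₃CCo (datumOfRecord₁₃Co θ' h') w ∧ ∀ P, Dag.B15_main (leavesP w P)`;
the guard by K0b ∕ K0a (`HasResidualsOfRecord.ztUnity`, FILE 9 v1.1 `slotsNondegenerate₁₃_liveRepin_of_hasResiduals` — NO proviso read).  N12 ALONE at its own world (the joint rung needs all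
thirteen nodes at ONE world: §4's four-pin sockets ∕ dag-n24-c's engine); NOT the stub; count-neutral. [cite: Balaban1989LargeFieldI, (0.2)–(0.6) p.176, Prop. 1 (1.78) p.194, (1.80) p.195, (1.89) p.198, (1.99)–(1.102) pp.200–201; Balaban1988Convergent, (3.16)–(3.22) pp.268–269 (the guard); Balaban1989LargeFieldII, Thm 1 + (0.1) pp.355–356 (bookkeeping)] -/
theorem exists_guarded_record₁₃CCo_b15_main_liveRepin₁₃_of_massLive_of_hasResiduals (hres : Θ.HasResidualsOfRecord F N)
    (h : (Θ.liveRepin₁₃ F N).Provisos₁₃Core F N) (hθ : Θ.Admissible F N)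
    (h12deg : ∀ P : B12.RunParams, P.K ≤ lamW.kSel P → B15Leaf (WOfRecord₁₃ F N (Θ.liveRepin₁₃ F N) lamW P))
    (h12pin : ∀ P : B12.RunParams, lamW.kSel P < P.K → lamW.D1100 P
      = rPrimeDataOfSel (reprTOfRecord₁₃ F N (Θ.liveRepin₁₃ F N) P (lamW.kSel P))
          ((Θ.liveRepin₁₃ F N).ppSel P (gOfRecord₁₃ F N (Θ.liveRepin₁₃ F N) P) (lamW.kSel P + 1))
          (fibOfSeq F (Θ.liveRepin₁₃ F N).ν (Θ.liveRepin₁₃ F N).τ9 P (gOfRecord₁₃ F N (Θ.liveRepin₁₃ F N) P) (lamW.kSel P + 1)))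
    (h12mass : ∀ P : B12.RunParams, lamW.kSel P < P.K → ∀ s, LiveSeq F N Θ.ν Θ.τ9 P (gOfRecord₁₃ F N (Θ.liveRepin₁₃ F N) P) (lamW.kSel P + 1)
        (slotsTOfRecord F N Θ.ν Θ.τ9 (EOfRecord₁₃ F N (Θ.liveRepin₁₃ F N)) (wOfRecord₉ F N (Θ.liveRepin₁₃ F N).toStage9Params)
          (Θ.liveRepin₁₃ F N).ppSel P (gOfRecord₁₃ F N (Θ.liveRepin₁₃ F N) P) (lamW.kSel P + 1)) s →
      0 < ∫ V, rterm (reprTOfRecord₁₃ F N (Θ.liveRepin₁₃ F N) P (lamW.kSel P)) s V ∂(fieldMeasure (F.P P.K) (lamW.kSel P + 1) (SU N)))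
    (h12P1 : ∀ P : B12.RunParams, lamW.kSel P < P.K → Prop1Printed (lamW.LF P))
    (h12i180 : ∀ P : B12.RunParams, lamW.kSel P < P.K → ∀ U, new189 (lamW.D189 P) U → ∀ i, (lamW.D189 P).h ≤ i → i ≤ (lamW.D189 P).k →
      ∀ q ∈ plaqsOf (dom (lamW.D189 P) i),
        Ineq180 ((lamW.D189 P).dev0 U q) ((lamW.D189 P).ε (lamW.D189 P).k) (lamW.D189 P).η (lamW.D189 P).B₃ (lamW.D189 P).B₅ (lamW.D189 P).M (lamW.D189 P).δ
          ((lamW.D189 P).dist q) (lamW.D189 P).O1)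
    (h12c189 : ∀ P : B12.RunParams, lamW.kSel P < P.K → Claim189 (new189 (lamW.D189 P)) (chiPP (lamW.D189 P))) :
    ∃ (θ' : Stage13Params F N) (h' : θ'.Provisos₁₃Core F N) (w : WorldP), (θ'.ZtUnity F N ∧ θ'.SlotsNondegenerate₁₃ F N) ∧ θ'.Admissible F N ∧
      IsRecordOfRecord₁₃CCo F N (datumOfRecord₁₃Co F N θ' h') w ∧ ∀ P : B12.RunParams, Dag.B15_main (leavesP w P) := by
  obtain ⟨w, hR, -, -, -, hN⟩ := exists_record₁₃CCo_pinWWorld_b15_main_liveRepin₁₃_of_massLive_of_hasResiduals Θ lamW hres h hθ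
    ⟨hθ.toStage9.gamma_pos, le_rfl⟩ h12deg h12pin h12mass h12P1 h12i180 h12c189
  exact ⟨Θ.liveRepin₁₃ F N, h, w, ⟨Stage13Params.ZtUnity.liveRepin₁₃ hres.ztUnity, Stage13Params.slotsNondegenerate₁₃_liveRepin_of_hasResiduals hres⟩,
    hθ.liveRepin₁₃, hR, hN⟩

end LiveStorey

section Thm1CStorey
variable (ε₀ ε₂₉ B₃ a₀ a₁ : ℝ) (lamW : ResidW F N)

/-- **★★★ THE RUNG-1 ∃-SHAPE AT THE CORE RECORD, N12's CONJUNCT ONLY, AT THE PLAN's `L`-KEYED WITNESS `θ₁₅ᶜ = theta13OfThm1C F N ε₀ ε₂₉ B₃ a₀ a₁`** (§1 at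
`Θ := theta13OfNumerics … (stage12NumericsOfThm1C F.L ε₀ B₃ a₀ a₁) …`, whose ₁₃ live re-pin IS `θ₁₅ᶜ`; K0b's residuals of record by K0a's `hasResidualsOfRecord_theta13OfNumerics`,
admissibility by K0a's `admissible_theta13OfNumerics` under the five witness signs): EDITION-SIDE INPUT = `h : Provisos₁₃Core θ₁₅ᶜ` ALONE (`hE.toCore`; read by the datum and the record predicate only);
N12's per-run displays as in 12E ∕ 12F ∕ 12G.  N12 ALONE at its own world; NOT the stub; count-neutral. [cite: Balaban1989LargeFieldI, (0.2)–(0.6) p.176, Prop. 1 (1.78) p.194, (1.80) p.195, (1.89) p.198, (1.99)–(1.102) pp.200–201; Balaban1988Convergent, (2.10) p.256, (3.16)–(3.22) pp.268–269; Balaban1989LargeFieldII, Thm 1 + (0.1) pp.355–356; Balaban1985Variational, Thm 1 p.279 (witness letters only)] -/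
theorem exists_guarded_record₁₃CCo_b15_main_theta13OfThm1C_of_massLive (hε : 0 < ε₀) (hε' : 0 < ε₂₉) (hB : 0 ≤ B₃) (ha₀ : 0 < a₀) (ha₁ : 0 < a₁)
    (h : (theta13OfThm1C F N ε₀ ε₂₉ B₃ a₀ a₁).Provisos₁₃Core F N)
    (h12deg : ∀ P : B12.RunParams, P.K ≤ lamW.kSel P → B15Leaf (WOfRecord₁₃ F N (theta13OfThm1C F N ε₀ ε₂₉ B₃ a₀ a₁) lamW P))
    (h12pin : ∀ P : B12.RunParams, lamW.kSel P < P.K → lamW.D1100 P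
      = rPrimeDataOfSel (reprTOfRecord₁₃ F N (theta13OfThm1C F N ε₀ ε₂₉ B₃ a₀ a₁) P (lamW.kSel P))
          ((theta13OfThm1C F N ε₀ ε₂₉ B₃ a₀ a₁).ppSel P (gOfRecord₁₃ F N (theta13OfThm1C F N ε₀ ε₂₉ B₃ a₀ a₁) P) (lamW.kSel P + 1))
          (fibOfSeq F (theta13OfThm1C F N ε₀ ε₂₉ B₃ a₀ a₁).ν (theta13OfThm1C F N ε₀ ε₂₉ B₃ a₀ a₁).τ9 P (gOfRecord₁₃ F N (theta13OfThm1C F N ε₀ ε₂₉ B₃ a₀ a₁) P) (lamW.kSel P + 1)))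
    (h12mass : ∀ P : B12.RunParams, lamW.kSel P < P.K → ∀ s, LiveSeq F N (theta13OfThm1C F N ε₀ ε₂₉ B₃ a₀ a₁).ν (theta13OfThm1C F N ε₀ ε₂₉ B₃ a₀ a₁).τ9 P (gOfRecord₁₃ F N (theta13OfThm1C F N ε₀ ε₂₉ B₃ a₀ a₁) P) (lamW.kSel P + 1)
        (slotsTOfRecord F N (theta13OfThm1C F N ε₀ ε₂₉ B₃ a₀ a₁).ν (theta13OfThm1C F N ε₀ ε₂₉ B₃ a₀ a₁).τ9 (EOfRecord₁₃ F N (theta13OfThm1C F N ε₀ ε₂₉ B₃ a₀ a₁)) (wOfRecord₉ F N (theta13OfThm1C F N ε₀ ε₂₉ B₃ a₀ a₁).toStage9Params)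
          (theta13OfThm1C F N ε₀ ε₂₉ B₃ a₀ a₁).ppSel P (gOfRecord₁₃ F N (theta13OfThm1C F N ε₀ ε₂₉ B₃ a₀ a₁) P) (lamW.kSel P + 1)) s →
      0 < ∫ V, rterm (reprTOfRecord₁₃ F N (theta13OfThm1C F N ε₀ ε₂₉ B₃ a₀ a₁) P (lamW.kSel P)) s V ∂(fieldMeasure (F.P P.K) (lamW.kSel P + 1) (SU N)))
    (h12P1 : ∀ P : B12.RunParams, lamW.kSel P < P.K → Prop1Printed (lamW.LF P))
    (h12i180 : ∀ P : B12.RunParams, lamW.kSel P < P.K → ∀ U, new189 (lamW.D189 P) U → ∀ i, (lamW.D189 P).h ≤ i → i ≤ (lamW.D189 P).k →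
      ∀ q ∈ plaqsOf (dom (lamW.D189 P) i),
        Ineq180 ((lamW.D189 P).dev0 U q) ((lamW.D189 P).ε (lamW.D189 P).k) (lamW.D189 P).η (lamW.D189 P).B₃ (lamW.D189 P).B₅ (lamW.D189 P).M (lamW.D189 P).δ
          ((lamW.D189 P).dist q) (lamW.D189 P).O1)
    (h12c189 : ∀ P : B12.RunParams, lamW.kSel P < P.K → Claim189 (new189 (lamW.D189 P)) (chiPP (lamW.D189 P))) :
    ∃ (θ' : Stage13Params F N) (h' : θ'.Provisos₁₃Core F N) (w : WorldP), (θ'.ZtUnity F N ∧ θ'.SlotsNondegenerate₁₃ F N) ∧ θ'.Admissible F N ∧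
      IsRecordOfRecord₁₃CCo F N (datumOfRecord₁₃Co F N θ' h') w ∧ ∀ P : B12.RunParams, Dag.B15_main (leavesP w P) :=
  exists_guarded_record₁₃CCo_b15_main_liveRepin₁₃_of_massLive_of_hasResiduals
    (theta13OfNumerics F N (stage12NumericsOfThm1C F.L ε₀ B₃ a₀ a₁) ε₂₉
      (zeta316OfRecord F N (stage12NumericsOfThm1C F.L ε₀ B₃ a₀ a₁).ν (stage12NumericsOfThm1C F.L ε₀ B₃ a₀ a₁).τ9.M (stage12NumericsOfThm1C F.L ε₀ B₃ a₀ a₁).A₁)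
      (RzOfRecord F N) (ZtOfRecord F N)) lamW
    (hasResidualsOfRecord_theta13OfNumerics F N (stage12NumericsOfThm1C F.L ε₀ B₃ a₀ a₁) ε₂₉) h
    (admissible_theta13OfNumerics F N (zeta316OfRecord F N (stage12NumericsOfThm1C F.L ε₀ B₃ a₀ a₁).ν (stage12NumericsOfThm1C F.L ε₀ B₃ a₀ a₁).τ9.M
      (stage12NumericsOfThm1C F.L ε₀ B₃ a₀ a₁).A₁) (RzOfRecord F N) (ZtOfRecord F N) (stage12NumericsOfThm1C_pos hε hB ha₀ ha₁) hε')
    h12deg h12pin h12mass h12P1 h12i180 h12c189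

end Thm1CStorey

/-! ## §2 THE MIXED W-PIN — THE BUNDLE OF RECORD BELOW THE TORUS, A DEGENERATE LEAF-CARRIER ON RUNS WHOSE SELECTED STEP IS NOT A PRINTED STEP (`P.K ≤ λ.kSel P`):
N12's storey and its rung-1 shape WITHOUT the `K ≤ kSel P` leaf (12J §3 at the CORE record; N12-only) -/

section BelowTorus
variable (θ : Stage13Params F N)

/-- **THE MIXED W-PIN ENGINE AT THE CORE RECORD**: for every admissible Stage-13 package with the core provisos and every residual layer `λ` whose bundle of record carries the leaf on the runs
`P` with `λ.kSel P < P.K` (the runs where step `λ.kSel P` IS one of print's `K` steps), there is a run-indexed [IV] bundle family `W₀` AGREEING WITH THE BUNDLE OF RECORD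
`WOfRecord₁₃ θ λ P` ON THOSE RUNS, carrying the leaf at every run, whose W-pinned world is a core record of `datumOfRecord₁₃Co θ h` with `Dag.B15_main` at every run.  On the
other runs (`P.K ≤ λ.kSel P`: the selected step is not a step of the run — at `K = 0` there is none) `W₀ P` is the degenerate leaf-carrier of this seat's g4
`exists_printedCarriers15_b15Leaf`, where print applies no basic step and the typed leaf would read junk levels of the K-blind tower recursion.  HONESTY: this removes a junk demand,
not a printed one; the per-run cost below the torus is unchanged. [cite: Balaban1989LargeFieldI, (0.1)–(0.6) pp.175–176 (the basic step is applied at the steps `k < K` of a run), Prop. 1 p.194; Balaban1989LargeFieldII, Thm 1 + (0.1) pp.355–356 (bookkeeping)] -/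
theorem exists_mixedPinW_record₁₃CCo_b15_main_of_leafBelow (h : θ.Provisos₁₃Core F N) (hθ : θ.Admissible F N) (lamW : ResidW F N)
    {γw : ℝ} (hγw : 0 < γw ∧ γw ≤ θ.γ) (h12 : ∀ P : B12.RunParams, lamW.kSel P < P.K → B15Leaf (WOfRecord₁₃ F N θ lamW P)) :
    ∃ W₀ : B12.RunParams → PrintedCarriers15, (∀ P : B12.RunParams, lamW.kSel P < P.K → W₀ P = WOfRecord₁₃ F N θ lamW P) ∧ (∀ P, B15Leaf (W₀ P)) ∧
      ∃ w : WorldP, IsRecordOfRecord₁₃CCo F N (datumOfRecord₁₃Co F N θ h) w ∧ w.γ = γw ∧ w.L = (θ.L : ℝ) ∧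
        (∀ P, w.up P = upOfRecord₅C F N ((θ.pinW F N W₀).toStage5₁₃Co F N) P) ∧ ∀ P : B12.RunParams, Dag.B15_main (leavesP w P) := by
  obtain ⟨Wd, hWd⟩ := N12AtRecord12Pointed.exists_printedCarriers15_b15Leaf (F.P 0)
  have hleaf : ∀ P : B12.RunParams, B15Leaf ((fun P : B12.RunParams => if lamW.kSel P < P.K then WOfRecord₁₃ F N θ lamW P else Wd) P) := fun P => by
    dsimp only
    split_ifs with hP
    exacts [h12 P hP, hWd]
  exact ⟨_, fun P hP => if_pos hP, hleaf, exists_record₁₃CCo_pinWWorld_b15_main_of_leaf θ h hθ _ hγw hleaf⟩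

end BelowTorus

section BelowTorusLive
variable (Θ : Stage13Params F N) (lamW : ResidW F N)

/-- **★ N12's CORE STOREY AT THE ₁₃ LIVE RE-PIN, MIXED W-PIN — NO `K ≤ kSel P` LEAF**: at the live re-pin of a `Θ` carrying K0b's residuals, N12's row on the runs below the
torus from 12E's per-run ★★ `b15Leaf_WOfRecord₁₃_liveRepin₁₃_of_massLive_of_hasResiduals` (pin equation + live-mass + Prop. 1 (1.78) + (1.80) + (1.89)), the other runs served by
the degenerate carrier (§2 engine).  Edition-side input: `h : Provisos₁₃Core` at the re-pin (datum ∕ record predicate only) and admissibility. [cite: Balaban1989LargeFieldI, (0.2)–(0.6) p.176, p.176 ll.14–16, Prop. 1 (1.78) p.194, (1.80) p.195, (1.89) p.198, (1.99)–(1.102) pp.200–201; Balaban1988Convergent, (3.16) p.268, (3.22)–(3.25) pp.269–270; Balaban1989LargeFieldII, Thm 1 + (0.1) pp.355–356] -/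
theorem exists_mixedPinW_record₁₃CCo_b15_main_liveRepin₁₃_of_massLive_of_hasResiduals (hres : Θ.HasResidualsOfRecord F N)
    (h : (Θ.liveRepin₁₃ F N).Provisos₁₃Core F N) (hθ : Θ.Admissible F N) {γw : ℝ} (hγw : 0 < γw ∧ γw ≤ Θ.γ)
    (h12pin : ∀ P : B12.RunParams, lamW.kSel P < P.K → lamW.D1100 P
      = rPrimeDataOfSel (reprTOfRecord₁₃ F N (Θ.liveRepin₁₃ F N) P (lamW.kSel P))
          ((Θ.liveRepin₁₃ F N).ppSel P (gOfRecord₁₃ F N (Θ.liveRepin₁₃ F N) P) (lamW.kSel P + 1))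
          (fibOfSeq F (Θ.liveRepin₁₃ F N).ν (Θ.liveRepin₁₃ F N).τ9 P (gOfRecord₁₃ F N (Θ.liveRepin₁₃ F N) P) (lamW.kSel P + 1)))
    (h12mass : ∀ P : B12.RunParams, lamW.kSel P < P.K → ∀ s, LiveSeq F N Θ.ν Θ.τ9 P (gOfRecord₁₃ F N (Θ.liveRepin₁₃ F N) P) (lamW.kSel P + 1)
        (slotsTOfRecord F N Θ.ν Θ.τ9 (EOfRecord₁₃ F N (Θ.liveRepin₁₃ F N)) (wOfRecord₉ F N (Θ.liveRepin₁₃ F N).toStage9Params)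
          (Θ.liveRepin₁₃ F N).ppSel P (gOfRecord₁₃ F N (Θ.liveRepin₁₃ F N) P) (lamW.kSel P + 1)) s →
      0 < ∫ V, rterm (reprTOfRecord₁₃ F N (Θ.liveRepin₁₃ F N) P (lamW.kSel P)) s V ∂(fieldMeasure (F.P P.K) (lamW.kSel P + 1) (SU N)))
    (h12P1 : ∀ P : B12.RunParams, lamW.kSel P < P.K → Prop1Printed (lamW.LF P))
    (h12i180 : ∀ P : B12.RunParams, lamW.kSel P < P.K → ∀ U, new189 (lamW.D189 P) U → ∀ i, (lamW.D189 P).h ≤ i → i ≤ (lamW.D189 P).k →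
      ∀ q ∈ plaqsOf (dom (lamW.D189 P) i),
        Ineq180 ((lamW.D189 P).dev0 U q) ((lamW.D189 P).ε (lamW.D189 P).k) (lamW.D189 P).η (lamW.D189 P).B₃ (lamW.D189 P).B₅ (lamW.D189 P).M (lamW.D189 P).δ
          ((lamW.D189 P).dist q) (lamW.D189 P).O1)
    (h12c189 : ∀ P : B12.RunParams, lamW.kSel P < P.K → Claim189 (new189 (lamW.D189 P)) (chiPP (lamW.D189 P))) :
    ∃ W₀ : B12.RunParams → PrintedCarriers15, (∀ P : B12.RunParams, lamW.kSel P < P.K → W₀ P = WOfRecord₁₃ F N (Θ.liveRepin₁₃ F N) lamW P) ∧ (∀ P, B15Leaf (W₀ P)) ∧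
      ∃ w : WorldP, IsRecordOfRecord₁₃CCo F N (datumOfRecord₁₃Co F N (Θ.liveRepin₁₃ F N) h) w ∧ w.γ = γw ∧ w.L = ((Θ.liveRepin₁₃ F N).L : ℝ) ∧
        (∀ P, w.up P = upOfRecord₅C F N (((Θ.liveRepin₁₃ F N).pinW F N W₀).toStage5₁₃Co F N) P) ∧ ∀ P : B12.RunParams, Dag.B15_main (leavesP w P) :=
  exists_mixedPinW_record₁₃CCo_b15_main_of_leafBelow (Θ.liveRepin₁₃ F N) h hθ.liveRepin₁₃ lamW hγw fun P hk =>
    N12AtRecord13OfResiduals.b15Leaf_WOfRecord₁₃_liveRepin₁₃_of_massLive_of_hasResiduals Θ lamW hres hk (h12pin P hk) (h12mass P hk) (h12P1 P hk)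
      (h12i180 P hk) (h12c189 P hk)

/-- **★★ THE RUNG-1 SHAPE, N12's CONJUNCT ONLY, WITNESSED BY `(Θ.liveRepin₁₃, h, w)` — NO `K ≤ kSel P` LEAF** (§1's ★★ with the handed leaf REMOVED by the mixed W-pin: the conclusion
never names `W`).  Guard a THEOREM of K0b ∕ K0a FILE 9 v1.1; N12's per-run displays below the torus only. [cite: Balaban1989LargeFieldI, (0.2)–(0.6) p.176, Prop. 1 (1.78) p.194, (1.80) p.195, (1.89) p.198, (1.99)–(1.102) pp.200–201; Balaban1988Convergent, (3.16)–(3.22) pp.268–269 (the guard); Balaban1989LargeFieldII, Thm 1 + (0.1) pp.355–356 (bookkeeping)] -/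
theorem exists_guarded_record₁₃CCo_b15_main_liveRepin₁₃_of_massLive_of_hasResiduals_below (hres : Θ.HasResidualsOfRecord F N)
    (h : (Θ.liveRepin₁₃ F N).Provisos₁₃Core F N) (hθ : Θ.Admissible F N)
    (h12pin : ∀ P : B12.RunParams, lamW.kSel P < P.K → lamW.D1100 P
      = rPrimeDataOfSel (reprTOfRecord₁₃ F N (Θ.liveRepin₁₃ F N) P (lamW.kSel P))
          ((Θ.liveRepin₁₃ F N).ppSel P (gOfRecord₁₃ F N (Θ.liveRepin₁₃ F N) P) (lamW.kSel P + 1))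
          (fibOfSeq F (Θ.liveRepin₁₃ F N).ν (Θ.liveRepin₁₃ F N).τ9 P (gOfRecord₁₃ F N (Θ.liveRepin₁₃ F N) P) (lamW.kSel P + 1)))
    (h12mass : ∀ P : B12.RunParams, lamW.kSel P < P.K → ∀ s, LiveSeq F N Θ.ν Θ.τ9 P (gOfRecord₁₃ F N (Θ.liveRepin₁₃ F N) P) (lamW.kSel P + 1)
        (slotsTOfRecord F N Θ.ν Θ.τ9 (EOfRecord₁₃ F N (Θ.liveRepin₁₃ F N)) (wOfRecord₉ F N (Θ.liveRepin₁₃ F N).toStage9Params)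
          (Θ.liveRepin₁₃ F N).ppSel P (gOfRecord₁₃ F N (Θ.liveRepin₁₃ F N) P) (lamW.kSel P + 1)) s →
      0 < ∫ V, rterm (reprTOfRecord₁₃ F N (Θ.liveRepin₁₃ F N) P (lamW.kSel P)) s V ∂(fieldMeasure (F.P P.K) (lamW.kSel P + 1) (SU N)))
    (h12P1 : ∀ P : B12.RunParams, lamW.kSel P < P.K → Prop1Printed (lamW.LF P))
    (h12i180 : ∀ P : B12.RunParams, lamW.kSel P < P.K → ∀ U, new189 (lamW.D189 P) U → ∀ i, (lamW.D189 P).h ≤ i → i ≤ (lamW.D189 P).k →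
      ∀ q ∈ plaqsOf (dom (lamW.D189 P) i),
        Ineq180 ((lamW.D189 P).dev0 U q) ((lamW.D189 P).ε (lamW.D189 P).k) (lamW.D189 P).η (lamW.D189 P).B₃ (lamW.D189 P).B₅ (lamW.D189 P).M (lamW.D189 P).δ
          ((lamW.D189 P).dist q) (lamW.D189 P).O1)
    (h12c189 : ∀ P : B12.RunParams, lamW.kSel P < P.K → Claim189 (new189 (lamW.D189 P)) (chiPP (lamW.D189 P))) :
    ∃ (θ' : Stage13Params F N) (h' : θ'.Provisos₁₃Core F N) (w : WorldP), (θ'.ZtUnity F N ∧ θ'.SlotsNondegenerate₁₃ F N) ∧ θ'.Admissible F N ∧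
      IsRecordOfRecord₁₃CCo F N (datumOfRecord₁₃Co F N θ' h') w ∧ ∀ P : B12.RunParams, Dag.B15_main (leavesP w P) := by
  obtain ⟨-, -, -, w, hR, -, -, -, hN⟩ := exists_mixedPinW_record₁₃CCo_b15_main_liveRepin₁₃_of_massLive_of_hasResiduals Θ lamW hres h hθ
    ⟨hθ.toStage9.gamma_pos, le_rfl⟩ h12pin h12mass h12P1 h12i180 h12c189
  exact ⟨Θ.liveRepin₁₃ F N, h, w, ⟨Stage13Params.ZtUnity.liveRepin₁₃ hres.ztUnity, Stage13Params.slotsNondegenerate₁₃_liveRepin_of_hasResiduals hres⟩,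
    hθ.liveRepin₁₃, hR, hN⟩

end BelowTorusLive

section BelowTorusThm1C
variable (ε₀ ε₂₉ B₃ a₀ a₁ : ℝ) (lamW : ResidW F N)

/-- **★★★ THE RUNG-1 SHAPE, N12's CONJUNCT ONLY, AT THE PLAN's WITNESS `θ₁₅ᶜ = theta13OfThm1C F N ε₀ ε₂₉ B₃ a₀ a₁` — NO `K ≤ kSel P` LEAF** (§1's ★★★ with the handed leaf REMOVED):
edition-side input `h : Provisos₁₃Core θ₁₅ᶜ` ALONE; N12's per-run displays below the torus only.  (The witness CLASS caveat of referee PLACEMENT-21 ∕ director №146 — live selector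
with `εreg = a₀` — concerns the K1 consequent, not this N12-only shape; §2's ★★ is generic in `Θ` and re-pins to any successor family by instantiation.) [cite: Balaban1989LargeFieldI, (0.2)–(0.6) p.176, Prop. 1 (1.78) p.194, (1.80) p.195, (1.89) p.198, (1.99)–(1.102) pp.200–201; Balaban1988Convergent, (2.10) p.256, (3.16)–(3.22) pp.268–269; Balaban1989LargeFieldII, Thm 1 + (0.1) pp.355–356; Balaban1985Variational, Thm 1 p.279 (witness letters only)] -/
theorem exists_guarded_record₁₃CCo_b15_main_theta13OfThm1C_of_massLive_below (hε : 0 < ε₀) (hε' : 0 < ε₂₉) (hB : 0 ≤ B₃) (ha₀ : 0 < a₀) (ha₁ : 0 < a₁)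
    (h : (theta13OfThm1C F N ε₀ ε₂₉ B₃ a₀ a₁).Provisos₁₃Core F N)
    (h12pin : ∀ P : B12.RunParams, lamW.kSel P < P.K → lamW.D1100 P
      = rPrimeDataOfSel (reprTOfRecord₁₃ F N (theta13OfThm1C F N ε₀ ε₂₉ B₃ a₀ a₁) P (lamW.kSel P))
          ((theta13OfThm1C F N ε₀ ε₂₉ B₃ a₀ a₁).ppSel P (gOfRecord₁₃ F N (theta13OfThm1C F N ε₀ ε₂₉ B₃ a₀ a₁) P) (lamW.kSel P + 1))
          (fibOfSeq F (theta13OfThm1C F N ε₀ ε₂₉ B₃ a₀ a₁).ν (theta13OfThm1C F N ε₀ ε₂₉ B₃ a₀ a₁).τ9 P (gOfRecord₁₃ F N (theta13OfThm1C F N ε₀ ε₂₉ B₃ a₀ a₁) P) (lamW.kSel P + 1)))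
    (h12mass : ∀ P : B12.RunParams, lamW.kSel P < P.K → ∀ s, LiveSeq F N (theta13OfThm1C F N ε₀ ε₂₉ B₃ a₀ a₁).ν (theta13OfThm1C F N ε₀ ε₂₉ B₃ a₀ a₁).τ9 P (gOfRecord₁₃ F N (theta13OfThm1C F N ε₀ ε₂₉ B₃ a₀ a₁) P) (lamW.kSel P + 1)
        (slotsTOfRecord F N (theta13OfThm1C F N ε₀ ε₂₉ B₃ a₀ a₁).ν (theta13OfThm1C F N ε₀ ε₂₉ B₃ a₀ a₁).τ9 (EOfRecord₁₃ F N (theta13OfThm1C F N ε₀ ε₂₉ B₃ a₀ a₁)) (wOfRecord₉ F N (theta13OfThm1C F N ε₀ ε₂₉ B₃ a₀ a₁).toStage9Params)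
          (theta13OfThm1C F N ε₀ ε₂₉ B₃ a₀ a₁).ppSel P (gOfRecord₁₃ F N (theta13OfThm1C F N ε₀ ε₂₉ B₃ a₀ a₁) P) (lamW.kSel P + 1)) s →
      0 < ∫ V, rterm (reprTOfRecord₁₃ F N (theta13OfThm1C F N ε₀ ε₂₉ B₃ a₀ a₁) P (lamW.kSel P)) s V ∂(fieldMeasure (F.P P.K) (lamW.kSel P + 1) (SU N)))
    (h12P1 : ∀ P : B12.RunParams, lamW.kSel P < P.K → Prop1Printed (lamW.LF P))
    (h12i180 : ∀ P : B12.RunParams, lamW.kSel P < P.K → ∀ U, new189 (lamW.D189 P) U → ∀ i, (lamW.D189 P).h ≤ i → i ≤ (lamW.D189 P).k →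
      ∀ q ∈ plaqsOf (dom (lamW.D189 P) i),
        Ineq180 ((lamW.D189 P).dev0 U q) ((lamW.D189 P).ε (lamW.D189 P).k) (lamW.D189 P).η (lamW.D189 P).B₃ (lamW.D189 P).B₅ (lamW.D189 P).M (lamW.D189 P).δ
          ((lamW.D189 P).dist q) (lamW.D189 P).O1)
    (h12c189 : ∀ P : B12.RunParams, lamW.kSel P < P.K → Claim189 (new189 (lamW.D189 P)) (chiPP (lamW.D189 P))) :
    ∃ (θ' : Stage13Params F N) (h' : θ'.Provisos₁₃Core F N) (w : WorldP), (θ'.ZtUnity F N ∧ θ'.SlotsNondegenerate₁₃ F N) ∧ θ'.Admissible F N ∧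
      IsRecordOfRecord₁₃CCo F N (datumOfRecord₁₃Co F N θ' h') w ∧ ∀ P : B12.RunParams, Dag.B15_main (leavesP w P) :=
  exists_guarded_record₁₃CCo_b15_main_liveRepin₁₃_of_massLive_of_hasResiduals_below
    (theta13OfNumerics F N (stage12NumericsOfThm1C F.L ε₀ B₃ a₀ a₁) ε₂₉
      (zeta316OfRecord F N (stage12NumericsOfThm1C F.L ε₀ B₃ a₀ a₁).ν (stage12NumericsOfThm1C F.L ε₀ B₃ a₀ a₁).τ9.M (stage12NumericsOfThm1C F.L ε₀ B₃ a₀ a₁).A₁)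
      (RzOfRecord F N) (ZtOfRecord F N)) lamW
    (hasResidualsOfRecord_theta13OfNumerics F N (stage12NumericsOfThm1C F.L ε₀ B₃ a₀ a₁) ε₂₉) h
    (admissible_theta13OfNumerics F N (zeta316OfRecord F N (stage12NumericsOfThm1C F.L ε₀ B₃ a₀ a₁).ν (stage12NumericsOfThm1C F.L ε₀ B₃ a₀ a₁).τ9.M
      (stage12NumericsOfThm1C F.L ε₀ B₃ a₀ a₁).A₁) (RzOfRecord F N) (ZtOfRecord F N) (stage12NumericsOfThm1C_pos hε hB ha₀ ha₁) hε')
    h12pin h12mass h12P1 h12i180 h12c189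

end BelowTorusThm1C

end Summit.QuantumFields.YangMills.BalabanUVNodes.N12AtRecord13Co
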